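import Summits.QuantumFields.YangMills.Theorems.AlphaInputsT3ACMinimiserPinKnitRecChi
import Summits.QuantumFields.YangMills.Theorems.AlphaInputsT3ACv3Chi
import HarnessLib

/-!
# `AlphaInputsT3ACv3OfDataSchemaChi` — ★★★ THE SUCCESSOR STUB 2′χ FROM ITS DISPLAY: `AlphaInputsT3AC.PinnedPartsT3ACRecRChi L → AlphaInputsT3ACv3RecChi L`
# (R-57χ NAME-MAP port «DataSchema ∕ MinimiserPin* knit ↦ …Chi», owner RULING g23-№2 ADDENDA 2∕5∕6, R57chi README «TO COME»): strategy B's assembly over the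
# read-local class in χ-currency `DataSchemaT3ACRChi ⇒ OfV3ChiAt`, the knits to the χ-socket, and the registered-text-level implication — lane `pub-balaban3d`, seat alpha-1 (g12)

Cell `ym3-torus`, route `UnitScaleTilt`; 2′χ = `AlphaInputsT3ACv3RecChi L` (`AlphaInputsT3ACv3Chi`, the re-typed (α) socket with print's lower row, owner ADDENDUM 5 H1ᴰ∕N-1) is the
stub the OWNER pens into 20520's v5kC and 19936's v5p9 (ONE registry-only C3).  This file makes its DISPLAY of record honest BY NAME: alpha-2's `ofV3At_of_dataSchemaT3R`
(HOME `D6L-STATUS-alpha2-g3.md` §4, the read-local re-cut after the located refutation-as-typed of (D6L)) and `…v3CoreNonemptyR` §§2–3 VERBATIM with the χ step data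
(`AlphaV3AC.StepDataV3ChiAC`, `toStepAlphaChi`) feeding the χ-record `AlphaV3AC.RunAlphaV3ChiAC` — every other line of the construction (measurable argmin selectors over
`𝒞_R(k, h, W)` at admissible `h ≠ triv`, the pinned [7]-family `Ut` at `triv`, r2∕r3∕(67)∕(68) BY MEMBERSHIP, (N1) at `k = 0`, terminal rows) is unchanged.
* §1 ★ `AlphaInputsT3AC.ofV3ChiAt_of_dataSchemaT3RChi : DataSchemaT3ACRChi F 𝔠 a₀ a₁ → AlphaInputsT3AC.OfV3ChiAt F 𝔠 a₀ a₁`.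
* §2 the knits to the χ-socket: `ofV3ChiAt_of_pinnedRowsRChi` ((O∀χ), (D6R)), `ofV3ChiAt_of_pinnedRowsRCChi` ((D6R-CHARGED) + `7L + 3 ≤ M₁`), `ofV3ChiAt_of_pinnedRows₂RCChi`
  (closed-form sizes + (O″χ)).
* §3 `ofV3ChiAt_of_pinnedPartsRChi_cast` (per family) and ★★★ `alphaInputsT3ACv3RecChi_of_pinnedPartsRecRChi : AlphaInputsT3AC.PinnedPartsT3ACRecRChi L → AlphaInputsT3ACv3RecChi L`
  — 2′χ re-cut to «(T) [7] Thm 1 `Thm1GlobalMinAt` + (D6R-CHARGED) + (O″χ) the χ data rows over `𝒞_R`, at a record with exact profile, small `a₁`, `C68 ≥ c_min`, `M₁ ≥ 7L + 3`»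
  (the constants shell being free: `pinnedPartsT3ACRecR_shell`).
HONEST YIELD ∕ FRAMING.  2′χ's ∃-package at the displayed record modulo the DISPLAYED schema; nothing of the cluster expansion ([Balaban1985UV3] §§2–3), of
[Balaban1985Variational] Thm 1 or of [Balaban1985Averaging] is proved; (T), (D6R-CHARGED), (O″χ) stay DISPLAYED (hypothesis schemas, never asserted).  Count-neutral helper
toward 2′χ; registry untouched; not a claim about d = 4, the continuum limit, or the mass gap.
References: T. Bałaban, Commun. Math. Phys. 102 (1985) 255–275 [Balaban1985UV3], (7) p. 257, (40)–(42) p. 266, (47) p. 267, (55) p. 269, (67)–(68) p. 273, Thm 2 p. 272;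
Commun. Math. Phys. 102 (1985) 277–309 [Balaban1985Variational], Thm 1 (6)–(8) pp. 278–279; Commun. Math. Phys. 98 (1985) 17–51 [Balaban1985Averaging], Prop. 2 (54) p. 26.
-/

set_option autoImplicit false

noncomputable section

namespace Summit.QuantumFields.YangMills.Theorems

open MeasureTheory Set
open scoped Matrix Matrix.Norms.L2Operator
open Literature.MathematicalPhysics.QuantumFieldTheory.Balaban1983to89
open Literature.MathematicalPhysics.QuantumFieldTheory.Balaban1983to89.B10 (pFun)
open Literature.MathematicalPhysics.QuantumFieldTheory.Balaban1983to89.T3ContinuumYM3Torus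
open Literature.MathematicalPhysics.QuantumFieldTheory.Balaban1983to89.T3UnitLawDensityEML (ℰp)
open Literature.MathematicalPhysics.QuantumFieldTheory.Balaban1983to89.T3UnitScaleTilt (θBal)
open Literature.MathematicalPhysics.QuantumFieldTheory.Balaban1983to89.T3LevelShift (fieldShift)
open Literature.MathematicalPhysics.QuantumFieldTheory.Balaban1983to89.T3PrintedRegularMinimiser (regFibrePr)
open Literature.MathematicalPhysics.QuantumFieldTheory.Balaban1983to89.T3PrintedMinimiserExistence (Thm1GlobalMinAt)
open Literature.MathematicalPhysics.QuantumFieldTheory.Balaban1983to89.ExpMeanLog (deltaSU)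
open Literature.MathematicalPhysics.QuantumFieldTheory.Balaban1983to89.B10Eq38TorusDomains (plaqsIn)
open Literature.MathematicalPhysics.QuantumFieldTheory.Balaban1983to89.B10Eq42TorusConstraint (bondsIn lam42 lam42_self)
open Literature.MathematicalPhysics.QuantumFieldTheory.Balaban1985CMP102
open Literature.MathematicalPhysics.QuantumFieldTheory.Balaban1985CMP102.Setting
open Summit.QuantumFields.Balaban3D.Carriers
open Summit.QuantumFields.Balaban3D.Proofs.Primitives
open Summit.QuantumFields.Balaban3D.Proofs.GroupModelLieC (lieC)
open Summit.QuantumFields.Balaban3D.Proofs.LiftBridge (liftCfg)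
open Summit.QuantumFields.Balaban3D.Proofs.TowerAC
open Summit.QuantumFields.Balaban3D.Proofs.StandardAC
open Summit.QuantumFields.Balaban3D.Proofs.InputsAC
open Summit.QuantumFields.Balaban3D.Proofs.AlphaAC (AlphaDataAC)
open Summit.QuantumFields.Balaban3D.Proofs.Thresholds (Q0 Q0_pos)
open Summit.QuantumFields.YangMills.Theorems.AlphaV3AC
open B7Prop2Explicit (C0 C0_pos)

/-! ## §1 The assembly: `DataSchemaT3ACRChi ⇒ OfV3ChiAt` -/

section Construction

variable {F : T3Family} {𝔠 : AlphaConsts F.L (suGroupModel 2).N} {a₀ a₁ : ℝ}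

/-- **★ STRATEGY B'S ASSEMBLY OVER THE READ-LOCAL CLASS IN χ-CURRENCY: `DataSchemaT3ACRChi F 𝔠 a₀ a₁ → AlphaInputsT3AC.OfV3ChiAt F 𝔠 a₀ a₁`.**  Alpha-2's
`ofV3At_of_dataSchemaT3R` VERBATIM with the χ step data feeding the χ-record (`StepDataV3ChiAC.toStepAlphaChi` in place of `StepDataV3AC.toStepAlpha`): `U_k(·, h) :=` the
displayed [7]-minimiser `Ut k` at `h = triv`, the measurable argmin selector over `𝒞_R(k, h, W)` (`exists_selector_adaptedClassT3R`) at ADMISSIBLE `h ≠ triv` (`1` at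
non-admissible histories and beyond `K` — no row reads them); rows r2∕r3∕`hLF67`∕`h68` BY MEMBERSHIP ((D6R) non-emptiness), `hU` by measurability, r1 and r2∕r3 at `triv`
(k ≥ 1) = (D5), r3 at `k = 0` = (N1), terminal rows = measurability + (D7).  HONEST YIELD: 2′χ's ∃-package at FIXED `𝔠` modulo the DISPLAYED χ-schema; nothing of the
cluster expansion is proved. [cite: Balaban1985UV3, Thm 2 p.272 + (40)–(42) p.266 + (47) p.267 + (67)–(68) p.273; Balaban1985Variational, Thm 1 (8) p.279] -/
theorem AlphaInputsT3AC.ofV3ChiAt_of_dataSchemaT3RChi (D : DataSchemaT3ACRChi F 𝔠 a₀ a₁) : AlphaInputsT3AC.OfV3ChiAt F 𝔠 a₀ a₁ := by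
  classical
  intro γ hγ hγ1 K
  obtain ⟨hN1, hne, Ut, hT, hD⟩ := D γ hγ hγ1 K
  obtain ⟨hUt0, hUtm, hr1, hr2t, hr3t⟩ := hT
  -- the measurable argmin selectors, level by level and admissible history by admissible history
  have hsel := fun (k : ℕ) (hk : k ≤ K) (h : Hist (F.P K) k)
      (_hh : Hist.Admissible 𝔠.lane.carrier.M₁ (rcolOf (T3Scales F γ hγ (hγ1.trans (sq_min_one_le _ 𝔠.gamma0_pos)) K) 𝔠.lane.carrier) k h) =>
    AlphaInputsT3AC.exists_selector_adaptedClassT3R (F := F) (𝔠 := 𝔠) (γ := γ) (hγ := hγ) (hγ1 := hγ1) (K := K) hk h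
  let sel : (k : ℕ) → Hist (F.P K) k → GaugeField (F.P K) k (Matrix.specialUnitaryGroup (Fin 2) ℂ) →
      GaugeField (F.P K) 0 (Matrix.specialUnitaryGroup (Fin 2) ℂ) :=
    fun k h => if hk : k ≤ K then
      (if hh : Hist.Admissible 𝔠.lane.carrier.M₁ (rcolOf (T3Scales F γ hγ (hγ1.trans (sq_min_one_le _ 𝔠.gamma0_pos)) K) 𝔠.lane.carrier) k h
        then Classical.choose (hsel k hk h hh).1 else fun _ => 1)
      else fun _ => 1
  let UkH : (k : ℕ) → Hist (F.P K) k → GaugeField (F.P K) k (Matrix.specialUnitaryGroup (Fin 2) ℂ) →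
      GaugeField (F.P K) 0 (Matrix.specialUnitaryGroup (Fin 2) ℂ) :=
    fun k h => if h = Hist.triv (F.P K) k then Ut k else sel k h
  have hpin : ∀ k, UkH k (Hist.triv (F.P K) k) = Ut k := fun k => if_pos rfl
  have hoff : ∀ (k : ℕ) (h : Hist (F.P K) k), h ≠ Hist.triv (F.P K) k → UkH k h = sel k h := fun k h hh => if_neg hh
  have hU0 : ∀ V : GaugeField (F.P K) 0 (Matrix.specialUnitaryGroup (Fin 2) ℂ), UkH 0 (Hist.triv (F.P K) 0) V = V := fun V => by
    rw [hpin]; exact hUt0 V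
  have hmeas : ∀ (k : ℕ) (h : Hist (F.P K) k), Measurable (UkH k h) := by
    intro k h
    by_cases ht : h = Hist.triv (F.P K) k
    · subst ht; rw [hpin]; exact hUtm k
    · rw [hoff k h ht]
      by_cases hk : k ≤ K
      · by_cases hh : Hist.Admissible 𝔠.lane.carrier.M₁ (rcolOf (T3Scales F γ hγ (hγ1.trans (sq_min_one_le _ 𝔠.gamma0_pos)) K) 𝔠.lane.carrier) k h
        · simp only [sel, dif_pos hk, dif_pos hh]; exact (Classical.choose_spec (hsel k hk h hh).1).1
        · simp only [sel, dif_pos hk, dif_neg hh]; exact measurable_const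
      · simp only [sel, dif_neg hk]; exact measurable_const
  have hmin : ∀ (k : ℕ), k ≤ K → ∀ (h : Hist (F.P K) k),
      Hist.Admissible 𝔠.lane.carrier.M₁ (rcolOf (T3Scales F γ hγ (hγ1.trans (sq_min_one_le _ 𝔠.gamma0_pos)) K) 𝔠.lane.carrier) k h →
      h ≠ Hist.triv (F.P K) k →
      ∀ (W : GaugeField (F.P K) k (Matrix.specialUnitaryGroup (Fin 2) ℂ)), (AlphaInputsT3AC.adaptedClassT3R F 𝔠 γ hγ hγ1 K k h W).Nonempty →
        UkH k h W ∈ AlphaInputsT3AC.adaptedClassT3R F 𝔠 γ hγ hγ1 K k h W ∧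
          IsMinOn (fun U : GaugeField (F.P K) 0 (Matrix.specialUnitaryGroup (Fin 2) ℂ) => wilsonAction4 U)
            (AlphaInputsT3AC.adaptedClassT3R F 𝔠 γ hγ hγ1 K k h W) (UkH k h W) := by
    intro k hk h hh ht W hW
    rw [hoff k h ht]
    simp only [sel, dif_pos hk, dif_pos hh]
    exact (Classical.choose_spec (hsel k hk h hh).1).2.1 W ((hsel k hk h hh).2 W hW)
  have hAd : AlphaInputsT3AC.AdaptedToT3R F 𝔠 γ hγ hγ1 K Ut UkH := ⟨hpin, hmeas, hmin⟩
  obtain ⟨𝔖, 𝔄, hsteps, hPm, hPb⟩ := hD UkH hU0 hAd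
  -- membership at non-trivial admissible histories
  have hmem : ∀ (k : ℕ), k ≤ K → ∀ (h : Hist (F.P K) k),
      Hist.Admissible 𝔠.lane.carrier.M₁ (rcolOf (T3Scales F γ hγ (hγ1.trans (sq_min_one_le _ 𝔠.gamma0_pos)) K) 𝔠.lane.carrier) k h →
      h ≠ Hist.triv (F.P K) k → ∀ (W : GaugeField (F.P K) k (Matrix.specialUnitaryGroup (Fin 2) ℂ)),
        UkH k h W ∈ AlphaInputsT3AC.adaptedClassT3R F 𝔠 γ hγ hγ1 K k h W :=
    fun k hk h hh ht W => (hmin k hk h hh ht W (hne k hk h hh ht W)).1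
  refine ⟨fun _ => Set.univ, fun k => UkH (k + 1) (Hist.triv (F.P K) (k + 1)), UkH, hU0, fun _ _ => rfl, 𝔖, 𝔄, ?_, ⟨?_, ?_, ?_⟩, ?_⟩
  · -- the χ (α) rows: steps = χ-DATA + hU; (67)/(68) by membership (vacuous at the trivial history)
    refine ⟨fun k hk => (hsteps k hk).toStepAlphaChi (fun h => hmeas k h), fun k hk h hh U => ?_, fun k hk h hh U => ?_⟩
    · by_cases ht : h = Hist.triv (F.P K) k
      · intro e he
        have he' : e ∈ Hist.disc (P := F.P K) (Hist.triv (F.P K) k) := ht ▸ he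
        rw [Hist.disc_triv] at he'
        exact absurd he' (Finset.notMem_empty e)
      · exact AlphaInputsT3AC.hLF67_of_mem_adaptedClassT3R (hmem k hk h hh ht U)
    · by_cases ht : h = Hist.triv (F.P K) k
      · intro e he
        have he' : e ∈ Hist.disc (P := F.P K) (Hist.triv (F.P K) k) := ht ▸ he
        rw [Hist.disc_triv] at he'
        exact absurd he' (Finset.notMem_empty e)
      · exact AlphaInputsT3AC.h68_of_mem_adaptedClassT3R hk (hmem k hk h hh ht U)
  · -- r1: the displayed [7] Thm 1 rows of `Ut`, pinned
    intro n hnK ε₁ ε₀ h1 h2 h3 h4 V hV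
    rw [hpin]
    exact hr1 n hnK ε₁ ε₀ h1 h2 h3 h4 V hV
  · -- r2
    intro k hk h W hc b hb
    by_cases ht : h = Hist.triv (F.P K) k
    · subst ht
      rw [hpin]
      rcases Nat.eq_zero_or_pos k with rfl | hk0
      · show Ut 0 W b = W b
        rw [hUt0]
      · exact hr2t k hk0 hk W hc b hb
    · exact AlphaInputsT3AC.constraint42_of_mem_adaptedClassT3R (hmem k hk h hc.1 ht W) hc b hb
  · -- r3
    intro k hk h W hc i hi s hs q hq
    by_cases ht : h = Hist.triv (F.P K) k
    · subst ht
      rw [hpin]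
      rcases Nat.eq_zero_or_pos k with rfl | hk0
      · obtain rfl : i = 0 := Nat.le_zero.mp hi
        obtain rfl : s = 0 := Nat.le_zero.mp hs
        rw [lam42_self] at hq
        have hlt := hc.2 q (Finset.mem_coe.mpr hq)
        have h1 : (((F.L : ℝ) ^ (0 - 0))⁻¹) ^ 2 = 1 := by simp
        rw [h1, mul_one, Nat.sub_zero]
        show GaugeGroup.dist1 (GaugeField.plaqHol (Ut 0 W) q) ≤ _
        rw [hUt0]
        have hK1 : K - 0 + 1 = K + 1 := by simp
        rw [hK1] at hlt
        exact (hlt.le).trans hN1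
      · exact hr3t k hk0 hk W hc i hi s hs q hq
    · exact AlphaInputsT3AC.regularity68Levels_of_mem_adaptedClassT3R (hmem k hk h hc.1 ht W) hc i hi s hs q hq
  · -- terminal rows
    exact ⟨fun h => hmeas K h, hPm, hPb⟩

end Construction

/-! ## §2 The knits to the χ-socket over the read-local class -/

section Knit

variable (F : T3Family) (𝔠 : AlphaConsts F.L (suGroupModel 2).N)

/-- ★★ **THE χ (α) PACKAGE FROM [7] THM 1 + SIZE CONDITIONS + (D6R) + THE χ DATA ROWS (O∀χ)**, through `ofV3ChiAt_of_dataSchemaT3RChi` — alpha-2's `ofV3At_of_pinnedRowsR` in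
χ-currency. [cite: Balaban1985UV3, Thm 2 p.272 + (47) p.267; Balaban1985Variational, Thm 1 (8) p.279] -/
theorem AlphaInputsT3AC.ofV3ChiAt_of_pinnedRowsRChi {a₀ a₁ : ℝ}
    (hT : Thm1GlobalMinAt F.L a₀ a₁ 𝔠.B₃) (hwin : 𝔠.B₃ * a₁ ≤ a₀)
    (hA3 : (143 * ((((3 + 4 : ℕ) : ℝ)) ^ 2 / 4) ^ 2) * (2 * (𝔠.B₃ * a₁)) ≤ 1 / 3)
    (hA2 : 2 * (2 * (𝔠.B₃ * a₁)) ≤ 2 * deltaSU (Fin 2) / (((3 + 4) * F.L : ℕ) : ℝ) ^ 2)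
    (hB₃ : 1 ≤ 2 * 𝔠.B₃) (hC : 4 * 𝔠.B₃ * (F.L : ℝ) ^ 2 * avgWindowFactor F.L ≤ 𝔠.C68)
    (hanti : (min 𝔠.gamma0 1) ^ 2 ≤ Real.exp (2 * (1 - 𝔠.p₀)))
    (hsmall : ∀ γ : ℝ, 0 < γ → γ ≤ (min 𝔠.gamma0 1) ^ 2 →
      ∀ K k : ℕ, 2 * (F.L : ℝ) ^ 2 * avgWindowFactor F.L * θBal F.L γ 𝔠.b₀ 𝔠.p₀ (K - k + 1) ≤ a₁)
    (hD6R : ∀ (γ : ℝ) (hγ : 0 < γ) (hγ1 : γ ≤ (min 𝔠.gamma0 1) ^ 2) (K : ℕ), AlphaInputsT3AC.AdaptedClassNonemptyT3R F 𝔠 γ hγ hγ1 K)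
    (hrows : ∀ (γ : ℝ) (hγ : 0 < γ) (hγ1 : γ ≤ (min 𝔠.gamma0 1) ^ 2) (K : ℕ)
      (Ut : (k : ℕ) → GaugeField (F.P K) k (Matrix.specialUnitaryGroup (Fin 2) ℂ) → GaugeField (F.P K) 0 (Matrix.specialUnitaryGroup (Fin 2) ℂ)),
      AlphaInputsT3AC.TrivMinimiserRowsT3 F 𝔠 γ hγ hγ1 a₀ a₁ K Ut → AlphaInputsT3AC.DataRowsT3RChi F 𝔠 γ hγ hγ1 K Ut) :
    AlphaInputsT3AC.OfV3ChiAt F 𝔠 a₀ a₁ :=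
  AlphaInputsT3AC.ofV3ChiAt_of_dataSchemaT3RChi (AlphaInputsT3AC.dataSchemaT3ACRChi_of_pinnedRows F 𝔠 hT hwin hA3 hA2 hB₃ hC hanti hsmall hD6R hrows)

/-- ★★ **THE χ (α) PACKAGE FROM [7] THM 1 + SIZE CONDITIONS (incl. `7L + 3 ≤ M₁`) + (D6R-CHARGED) + THE χ DATA ROWS (O∀χ)** — `ofV3ChiAt_of_pinnedRowsRChi` with `hD6R` supplied by
`adaptedClassNonemptyT3R_of_charged_of_collar` ((N2′) ⇐ `collarE_T3_of_M₁_ge`, `4π ≤ C68` ⇐ `four_pi_le_C68_of_sizes`); alpha-2's `ofV3At_of_pinnedRowsRC` in χ-currency.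
[cite: Balaban1985UV3, Thm 2 p.272 + (40)–(42) p.266 + (47) p.267 + (67)–(68) p.273; Balaban1985Variational, Thm 1 (8) p.279] -/
theorem AlphaInputsT3AC.ofV3ChiAt_of_pinnedRowsRCChi {a₀ a₁ : ℝ}
    (hT : Thm1GlobalMinAt F.L a₀ a₁ 𝔠.B₃) (hwin : 𝔠.B₃ * a₁ ≤ a₀)
    (hA3 : (143 * ((((3 + 4 : ℕ) : ℝ)) ^ 2 / 4) ^ 2) * (2 * (𝔠.B₃ * a₁)) ≤ 1 / 3)
    (hA2 : 2 * (2 * (𝔠.B₃ * a₁)) ≤ 2 * deltaSU (Fin 2) / (((3 + 4) * F.L : ℕ) : ℝ) ^ 2)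
    (hB₃ : 1 ≤ 2 * 𝔠.B₃) (hC : 4 * 𝔠.B₃ * (F.L : ℝ) ^ 2 * avgWindowFactor F.L ≤ 𝔠.C68)
    (hanti : (min 𝔠.gamma0 1) ^ 2 ≤ Real.exp (2 * (1 - 𝔠.p₀)))
    (hsmall : ∀ γ : ℝ, 0 < γ → γ ≤ (min 𝔠.gamma0 1) ^ 2 →
      ∀ K k : ℕ, 2 * (F.L : ℝ) ^ 2 * avgWindowFactor F.L * θBal F.L γ 𝔠.b₀ 𝔠.p₀ (K - k + 1) ≤ a₁)
    (hM₁ : 7 * F.L + 3 ≤ 𝔠.M₁)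
    (hD6RC : ∀ (γ : ℝ) (hγ : 0 < γ) (hγ1 : γ ≤ (min 𝔠.gamma0 1) ^ 2) (K : ℕ), AlphaInputsT3AC.AdaptedClassNonemptyChargedT3R F 𝔠 γ hγ hγ1 K)
    (hrows : ∀ (γ : ℝ) (hγ : 0 < γ) (hγ1 : γ ≤ (min 𝔠.gamma0 1) ^ 2) (K : ℕ)
      (Ut : (k : ℕ) → GaugeField (F.P K) k (Matrix.specialUnitaryGroup (Fin 2) ℂ) → GaugeField (F.P K) 0 (Matrix.specialUnitaryGroup (Fin 2) ℂ)),
      AlphaInputsT3AC.TrivMinimiserRowsT3 F 𝔠 γ hγ hγ1 a₀ a₁ K Ut → AlphaInputsT3AC.DataRowsT3RChi F 𝔠 γ hγ hγ1 K Ut) :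
    AlphaInputsT3AC.OfV3ChiAt F 𝔠 a₀ a₁ :=
  AlphaInputsT3AC.ofV3ChiAt_of_pinnedRowsRChi F 𝔠 hT hwin hA3 hA2 hB₃ hC hanti hsmall
    (fun γ hγ hγ1 K => AlphaInputsT3AC.adaptedClassNonemptyT3R_of_charged_of_collar
      (AlphaInputsT3AC.collarE_T3_of_M₁_ge (hγ := hγ) (hγ1 := hγ1) (K := K) hM₁)
      (AlphaInputsT3AC.four_pi_le_C68_of_sizes (𝔠 := 𝔠) hB₃ hC) (hD6RC γ hγ hγ1 K))
    hrows

/-- ★★ **THE χ (α) PACKAGE FROM [7] THM 1, (D6R-CHARGED), THE PRINT-STRENGTH χ DATA ROW (O″χ) AND SIZES IN CLOSED FORM** (through `ofV3ChiAt_of_dataSchemaT3RChi` after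
`dataSchemaT3ACRChi_of_pinnedRows₂C`); alpha-2's `ofV3At_of_pinnedRows₂RC` in χ-currency. [cite: Balaban1985UV3, Thm 2 p.272 + (47) p.267; Balaban1985Variational, Thm 1 (8) p.279] -/
theorem AlphaInputsT3AC.ofV3ChiAt_of_pinnedRows₂RCChi {a₀ a₁ : ℝ}
    (hT : Thm1GlobalMinAt F.L a₀ a₁ 𝔠.B₃) (ha₁ : 0 < a₁) (hwin : 𝔠.B₃ * a₁ ≤ a₀)
    (hA3 : (143 * ((((3 + 4 : ℕ) : ℝ)) ^ 2 / 4) ^ 2) * (2 * (𝔠.B₃ * a₁)) ≤ 1 / 3)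
    (hA2 : 2 * (2 * (𝔠.B₃ * a₁)) ≤ 2 * deltaSU (Fin 2) / (((3 + 4) * F.L : ℕ) : ℝ) ^ 2)
    (hB₃ : 1 ≤ 2 * 𝔠.B₃) (hC : 4 * 𝔠.B₃ * (F.L : ℝ) ^ 2 * avgWindowFactor F.L ≤ 𝔠.C68)
    (hCe : Real.exp (𝔠.p₀ - 1) ≤ 3 * C0 3 * 𝔠.C68 * (𝔠.b₀ * Q0 𝔠.p₀))
    (hCa : (𝔠.b₀ * Q0 𝔠.p₀) * (2 * (F.L : ℝ) ^ 2 * avgWindowFactor F.L) ^ 2 ≤ 3 * C0 3 * 𝔠.C68 * a₁ ^ 2)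
    (hM₁ : 7 * F.L + 3 ≤ 𝔠.M₁)
    (hD6RC : ∀ (γ : ℝ) (hγ : 0 < γ) (hγ1 : γ ≤ (min 𝔠.gamma0 1) ^ 2) (K : ℕ), AlphaInputsT3AC.AdaptedClassNonemptyChargedT3R F 𝔠 γ hγ hγ1 K)
    (hrows : ∀ (γ : ℝ) (hγ : 0 < γ) (hγ1 : γ ≤ (min 𝔠.gamma0 1) ^ 2) (K : ℕ),
      (∃ Ut : (k : ℕ) → GaugeField (F.P K) k (Matrix.specialUnitaryGroup (Fin 2) ℂ) → GaugeField (F.P K) 0 (Matrix.specialUnitaryGroup (Fin 2) ℂ),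
        AlphaInputsT3AC.TrivMinimiserRowsT3 F 𝔠 γ hγ hγ1 a₀ a₁ K Ut) →
      ∃ Ut : (k : ℕ) → GaugeField (F.P K) k (Matrix.specialUnitaryGroup (Fin 2) ℂ) → GaugeField (F.P K) 0 (Matrix.specialUnitaryGroup (Fin 2) ℂ),
        AlphaInputsT3AC.TrivMinimiserRowsT3 F 𝔠 γ hγ hγ1 a₀ a₁ K Ut ∧ AlphaInputsT3AC.DataRowsT3RChi F 𝔠 γ hγ hγ1 K Ut) :
    AlphaInputsT3AC.OfV3ChiAt F 𝔠 a₀ a₁ :=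
  AlphaInputsT3AC.ofV3ChiAt_of_dataSchemaT3RChi
    (AlphaInputsT3AC.dataSchemaT3ACRChi_of_pinnedRows₂C F 𝔠 hT ha₁ hwin hA3 hA2 hB₃ hC hCe hCa hM₁ hD6RC hrows)

end Knit

/-! ## §3 ★★★ The successor stub 2′χ from its display -/

section Record

/-- At a family of block size `L` the body of `PinnedPartsT3ACRecRChi` gives `OfV3ChiAt` (§2 after transport along `hF`). [cite: Balaban1985UV3, Thm 2 p.272 + (47) p.267; Balaban1985Variational, Thm 1 (8) p.279] -/
theorem AlphaInputsT3AC.ofV3ChiAt_of_pinnedPartsRChi_cast {L : ℕ} {𝔠 : AlphaConsts L (suGroupModel 2).N} {a₀ a₁ : ℝ}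
    (ha₁ : 0 < a₁) (hwin : 𝔠.B₃ * a₁ ≤ a₀)
    (hA3 : (143 * ((((3 + 4 : ℕ) : ℝ)) ^ 2 / 4) ^ 2) * (2 * (𝔠.B₃ * a₁)) ≤ 1 / 3)
    (hA2 : 2 * (2 * (𝔠.B₃ * a₁)) ≤ 2 * deltaSU (Fin 2) / (((3 + 4) * L : ℕ) : ℝ) ^ 2)
    (hB₃ : 1 ≤ 2 * 𝔠.B₃) (hC : 4 * 𝔠.B₃ * (L : ℝ) ^ 2 * avgWindowFactor L ≤ 𝔠.C68)
    (hCe : Real.exp (𝔠.p₀ - 1) ≤ 3 * C0 3 * 𝔠.C68 * (𝔠.b₀ * Q0 𝔠.p₀))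
    (hCa : (𝔠.b₀ * Q0 𝔠.p₀) * (2 * (L : ℝ) ^ 2 * avgWindowFactor L) ^ 2 ≤ 3 * C0 3 * 𝔠.C68 * a₁ ^ 2)
    (hM₁ : 7 * L + 3 ≤ 𝔠.M₁)
    (hT : Thm1GlobalMinAt L a₀ a₁ 𝔠.B₃) (F : T3Family) (hF : F.L = L)
    (hD6RC : ∀ (γ : ℝ) (hγ : 0 < γ) (hγ1 : γ ≤ (min (hF ▸ 𝔠).gamma0 1) ^ 2) (K : ℕ),
      AlphaInputsT3AC.AdaptedClassNonemptyChargedT3R F (hF ▸ 𝔠) γ hγ hγ1 K)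
    (hrows : ∀ (γ : ℝ) (hγ : 0 < γ) (hγ1 : γ ≤ (min (hF ▸ 𝔠).gamma0 1) ^ 2) (K : ℕ),
      (∃ Ut : (k : ℕ) → GaugeField (F.P K) k (Matrix.specialUnitaryGroup (Fin 2) ℂ) → GaugeField (F.P K) 0 (Matrix.specialUnitaryGroup (Fin 2) ℂ),
        AlphaInputsT3AC.TrivMinimiserRowsT3 F (hF ▸ 𝔠) γ hγ hγ1 a₀ a₁ K Ut) →
      ∃ Ut : (k : ℕ) → GaugeField (F.P K) k (Matrix.specialUnitaryGroup (Fin 2) ℂ) → GaugeField (F.P K) 0 (Matrix.specialUnitaryGroup (Fin 2) ℂ),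
        AlphaInputsT3AC.TrivMinimiserRowsT3 F (hF ▸ 𝔠) γ hγ hγ1 a₀ a₁ K Ut ∧ AlphaInputsT3AC.DataRowsT3RChi F (hF ▸ 𝔠) γ hγ hγ1 K Ut) :
    AlphaInputsT3AC.OfV3ChiAt F (hF ▸ 𝔠) a₀ a₁ := by
  subst hF
  exact AlphaInputsT3AC.ofV3ChiAt_of_pinnedRows₂RCChi F 𝔠 hT ha₁ hwin hA3 hA2 hB₃ hC hCe hCa hM₁ hD6RC hrows

/-- ★★★ **THE SUCCESSOR STUB 2′χ FROM ITS READ-LOCAL DISPLAY**: `AlphaInputsT3AC.PinnedPartsT3ACRecRChi L → AlphaInputsT3ACv3RecChi L` — 2′χ `stub_laneRecordsV3chi` (the record-parametric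
χ-socket of `AlphaInputsT3ACv3Chi`, print's lower row with print's χ) re-cut to «(T) [7] Thm 1 `Thm1GlobalMinAt` + (D6R-CHARGED) + (O″χ) the χ data rows over `𝒞_R`, at a record
with exact profile, small `a₁`, `C68 ≥ c_min` and `M₁ ≥ 7L + 3» (alpha-2's `alphaInputsT3ACv3Rec_of_pinnedPartsRecR` in χ-currency; the constants shell is free by
`pinnedPartsT3ACRecR_shell`). [cite: Balaban1985UV3, Thm 2 p.272 + (47) p.267; Balaban1985Variational, Thm 1 (8) p.279] -/
theorem alphaInputsT3ACv3RecChi_of_pinnedPartsRecRChi {L : ℕ} (h : AlphaInputsT3AC.PinnedPartsT3ACRecRChi L) : AlphaInputsT3ACv3RecChi L := by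
  obtain ⟨b₁, p₁, h⟩ := h
  refine ⟨b₁, p₁, fun b₀ p₀ hb hp => ?_⟩
  obtain ⟨𝔠, a₀, a₁, h1, h2, h3, h4, h5, hA3, hA2, hB₃, hC, hCe, hCa, hM₁, hT, hD⟩ := h b₀ p₀ hb hp
  exact ⟨𝔠, a₀, a₁, h1, h2, h3, h4, h5, fun F hF =>
    AlphaInputsT3AC.ofV3ChiAt_of_pinnedPartsRChi_cast h4 h5 hA3 hA2 hB₃ hC hCe hCa hM₁ hT F hF (hD F hF).1 (hD F hF).2⟩

end Record

end Summit.QuantumFields.YangMills.Theorems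

end
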